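import Summits.AtomisticToContinuum.Crystallization.Theorems.FrustratedLawDichotomyStrainedPatchHomEntrySemanticQuotA

/-!
# The quotient currency `semOKHQ` does not read the lower-triangle box coordinates (hand-1 g44)

`semOKHQ μ c w` (…EntrySemanticQuotA §3) constrains all twelve coordinates `hcpCoord U ξ k` of an admissible pair, including the
three LOWER-triangle entries `(U e_b)_a`, `b < a`, which for a self-adjoint `U` equal their mirrors (`…EntryTable.entries_symm`).
Certified boxes are produced in two conventions for those three coordinates — «literal copies of the upper entries» (census / hand-1
U-boxes `cH_full`, `cG_full`, the landed pilot cube `c_pc/w_pc`) and «root values `0 ± 2⁴⁶`» (every box cut from the quarter root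
`rootCHQ/rootWHQ`, hence every `coveredAt` leaf of a root manifest, …QuotColumn §3).  This file proves the bridge: a `semOKHQ` fact on a
box whose lower-triangle coordinates are COPIES of its upper ones transfers to ANY box with the same diagonal, upper-triangle and shuffle
coordinates, whatever its lower-triangle values — so listed quotient facts in the copy convention serve root-cut manifest leaves.

0 sorry; theorems only (no defs / instances / notation); the agreement / copy hypotheses are decidable on literal boxes (`decide`).  `--supports stmt-AtomisticToContinuum-27623` (crux `AperiodicFrustratedLawGap`).
-/

namespace Summit.AtomisticToContinuum.Crystallization.Theorems.FrustratedLawDichotomyStrainedPatchHomEntrySemanticQuotLower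

open scoped RealInnerProductSpace
open Literature.Analysis.ValidatedNumerics.Numerics
open Summit.AtomisticToContinuum.Crystallization.Theorems.ChargedEnergyGapNegative (E3)
open Summit.AtomisticToContinuum.Crystallization.Theorems.FrustratedLawDichotomyStrainedPatchHomEntryLeafHT (hcpCoord)
open Summit.AtomisticToContinuum.Crystallization.Theorems.FrustratedLawDichotomyStrainedPatchHomEntrySemanticQuot (semOKHQ semOKHQ_of_forall semOKHQ_forall)
open Summit.AtomisticToContinuum.Crystallization.Theorems.FrustratedLawDichotomyStrainedPatchHomEntryTable (entries_symm)

/-- For a self-adjoint `U` the lower-triangle box coordinate `(a, b)`, `b < a`, equals its mirror `(b, a)`. [formal bookkeeping] -/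
theorem hcpCoord_lower_eq {U : E3 →L[ℝ] E3} (hsa : ∀ v v' : E3, ⟪U v, v'⟫ = ⟪v, U v'⟫) (ξ : E3) (a b : Fin 3) :
    hcpCoord U ξ (Sum.inl (a, b)) = hcpCoord U ξ (Sum.inl (b, a)) := by
  simp only [hcpCoord, Sum.elim_inl]
  exact entries_symm hsa a b

/-- ★ **LOWER-TRIANGLE TRANSFER for the quotient currency.**  If `semOKHQ μ c' w'` holds on a box `(c', w')` whose lower-triangle coordinates
are copies of its upper-triangle ones, then `semOKHQ μ c w` holds on every box `(c, w)` that agrees with `(c', w')` on the diagonal, the upper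
triangle and the three shuffle coordinates — its lower-triangle values are arbitrary (e.g. the root values `0 ± 2⁴⁶` of a manifest leaf).
[formal bookkeeping: `semOKHQ_of_forall` / `semOKHQ_forall` + `entries_symm`] -/
theorem semOKHQ_of_upper_agree {μ : ℤ} {c w c' w' : (Fin 3 × Fin 3) ⊕ Fin 3 → ℤ} (h : semOKHQ μ c' w' = true)
    (hup : ∀ a b : Fin 3, a ≤ b → c (Sum.inl (a, b)) = c' (Sum.inl (a, b)) ∧ w (Sum.inl (a, b)) = w' (Sum.inl (a, b)))
    (hsh : ∀ i : Fin 3, c (Sum.inr i) = c' (Sum.inr i) ∧ w (Sum.inr i) = w' (Sum.inr i))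
    (hlow : ∀ a b : Fin 3, b < a → c' (Sum.inl (a, b)) = c' (Sum.inl (b, a)) ∧ w' (Sum.inl (a, b)) = w' (Sum.inl (b, a))) :
    semOKHQ μ c w = true := by
  refine semOKHQ_of_forall fun U ξ hsa hpos hU hξ hmem hb hab => semOKHQ_forall h U ξ hsa hpos hU hξ (fun k => ?_) hb hab
  rcases k with ⟨a, b⟩ | i
  · by_cases hle : a ≤ b
    · obtain ⟨hc, hw⟩ := hup a b hle
      rw [← hc, ← hw]; exact hmem (Sum.inl (a, b))
    · have hlt : b < a := lt_of_not_ge hle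
      obtain ⟨hc', hw'⟩ := hlow a b hlt
      obtain ⟨hc, hw⟩ := hup b a hlt.le
      rw [hc', hw', hcpCoord_lower_eq hsa ξ a b, ← hc, ← hw]
      exact hmem (Sum.inl (b, a))
  · obtain ⟨hc, hw⟩ := hsh i
    rw [← hc, ← hw]; exact hmem (Sum.inr i)

end Summit.AtomisticToContinuum.Crystallization.Theorems.FrustratedLawDichotomyStrainedPatchHomEntrySemanticQuotLower
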